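import Mathlib
import Summits.NavierStokesRegularity.NavierStokesRegularity.Theorems.WakeRatchetTailRatchetDyadicScalarEternal
import Summits.NavierStokesRegularity.NavierStokesRegularity.Theorems.WakeRatchetExtractionAscoli
import HarnessLib

/-!
# `WakeRatchet.TailRatchet` (stmt-NavierStokesRegularity-21808), door D4′ — the SCALAR EXTRACTION:
# bounded scalar frames of the renormalised dyadic lattice with uniform window mass, forward energy
# bounds and persistent firing refute the crux (Arzelà–Ascoli + passage to the limit, all scalar)

Def-free.  MODEL lattice ODEs only (the scalar dyadic member of Tao 2016 §1.2 / §4 in the renormalised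
variables of §6.4); nothing in this file is a statement about the Navier–Stokes equations; stmt-21808 is
neither proved nor refuted here and no stub of skeleton d00b85951d7c is closed.

WHY.  After `WakeRatchetDyadicScalarEternal.tailRatchet_false_of_scalarPersistentFiring` (the scalar kill
criterion) the only non-elementary step left between the Cauchy side of door D4′ (the non-negative dyadic
blow-up: `WakeRatchetDyadicCauchy.dyadic_blowup_typeI`, recentred frames) and the refutation is the
EXTRACTION of an admissible eternal limit.  This file performs it for SCALAR frames `V_j : ℤ → ℝ → ℝ`
solving the renormalised dyadic lattice on growing half-lines `σ > A_j`, `A_j → −∞`: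

* `frame_lipschitz` — a uniform bound `|V_j| ≤ B` makes every shell `K`-Lipschitz in log-time on its
  half-line, `K = B + (Λ + Λ⁻¹)B²` (equicontinuity from the equation).
* `lattice_law_of_cc` — a CONTINUOUS limit `W` of such frames (`u_j → σ ⇒ V_j n u_j → W n σ`) solves the
  lattice at every shell and log-time (integral form, dominated convergence, fundamental theorem).
* `windowMass_of_cc`, `integrable_of_windowMass` — a uniform window-mass bound `∫_a^b |V_j n| ≤ M`
  passes to the limit and gives `Integrable (W n)` with `∫|W n| ≤ M` (the action clause of `IsEternal`).
* `tailRatchet_false_of_scalarFrameLimit` — frames + continuous limit + uniform bound + window mass +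
  per-shell forward energy bound + persistent firing at fixed log-times ⇒ `¬ TailRatchet`.
* `tailRatchet_false_of_scalarFrames` — the same WITHOUT the limit: Arzelà–Ascoli
  (`exists_subseq_continuousLimit` of file `WakeRatchetExtractionAscoli`) supplies it along a subsequence.

So door D4′ is reduced to exhibiting, at arbitrarily small `ε₀`, bounded scalar frames of the dyadic
Cauchy blow-up with (i) a uniform WINDOW-MASS bound (the census's (M) = (Q) quietness + (D) wake decay),
(ii) a per-shell forward energy bound uniform in the frame index, (iii) persistent firing at fixed recentred
log-times (the firing clock).  (i)–(iii) are the remaining analytic debt; nothing else is.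

HONEST FRAMING: compactness bookkeeping; (Q), (D) and the clock for the one-shell dyadic blow-up are NOT
addressed; rung 0.
-/

noncomputable section

set_option linter.dupNamespace false

namespace Summit.NavierStokesRegularity.NavierStokesRegularity.Theorems

namespace WakeRatchetDyadicScalarEternal

open Set Filter Topology MeasureTheory intervalIntegral
open Literature.Analysis.FluidPDE Literature.Analysis.FluidPDE.TaoCascade
open Summit.NavierStokesRegularity.NavierStokesRegularity.Theses.WakeRatchet

/-! ## Equicontinuity of bounded frames -/

/-- **Bounded frames are equi-Lipschitz.**  If `V` solves `V_n' = −V_n + ΛV²_{n−1} − Λ⁻¹V_nV_{n+1}` on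
`σ > A` at every shell with `|V_n| ≤ B` there (`Λ > 0`), then every shell is `K`-Lipschitz on `(A, ∞)`
with `K = B + (Λ + Λ⁻¹)B²`.
[cite: Tao2016AveragedNS, §1.2, §4 Lemma 4.1 (4.8), §6.4; elementary] -/
theorem frame_lipschitz {Λ B A : ℝ} (hΛ : 0 < Λ) {V : ℤ → ℝ → ℝ}
    (hlaw : ∀ (n : ℤ) (σ : ℝ), A < σ → HasDerivAt (V n)
      (-(V n σ) + Λ * V (n - 1) σ ^ 2 - Λ⁻¹ * V n σ * V (n + 1) σ) σ)
    (hB : ∀ (n : ℤ) (σ : ℝ), A < σ → |V n σ| ≤ B) (n : ℤ) {u v : ℝ} (hu : A < u) (hv : A < v) :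
    |V n u - V n v| ≤ (B + (Λ + Λ⁻¹) * B ^ 2) * |u - v| := by
  have hΛi : 0 < Λ⁻¹ := inv_pos.2 hΛ
  have hB0 : 0 ≤ B := (abs_nonneg _).trans (hB n u hu)
  have hseg : uIcc v u ⊆ Ioi A := by
    rcases le_total v u with h | h
    · rw [uIcc_of_le h]; exact fun x hx => lt_of_lt_of_le hv hx.1
    · rw [uIcc_of_ge h]; exact fun x hx => lt_of_lt_of_le hu hx.1
  have hder : ∀ x ∈ uIcc v u, HasDerivWithinAt (V n)
      (-(V n x) + Λ * V (n - 1) x ^ 2 - Λ⁻¹ * V n x * V (n + 1) x) (uIcc v u) x :=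
    fun x hx => (hlaw n x (hseg hx)).hasDerivWithinAt
  have hbd : ∀ x ∈ uIcc v u, ‖-(V n x) + Λ * V (n - 1) x ^ 2 - Λ⁻¹ * V n x * V (n + 1) x‖
      ≤ B + (Λ + Λ⁻¹) * B ^ 2 := by
    intro x hx
    have hx' := hseg hx
    have h1 := hB n x hx'; have h2 := hB (n - 1) x hx'; have h3 := hB (n + 1) x hx'
    rw [Real.norm_eq_abs]
    have e1 : |Λ * V (n - 1) x ^ 2| ≤ Λ * B ^ 2 := by
      rw [abs_mul, abs_of_pos hΛ, abs_pow]
      exact mul_le_mul_of_nonneg_left (pow_le_pow_left₀ (abs_nonneg _) h2 2) hΛ.le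
    have e2 : |Λ⁻¹ * V n x * V (n + 1) x| ≤ Λ⁻¹ * B ^ 2 := by
      rw [abs_mul, abs_mul, abs_of_pos hΛi, mul_assoc, sq]
      exact mul_le_mul_of_nonneg_left (mul_le_mul h1 h3 (abs_nonneg _) hB0) hΛi.le
    calc |-(V n x) + Λ * V (n - 1) x ^ 2 - Λ⁻¹ * V n x * V (n + 1) x|
        ≤ |-(V n x) + Λ * V (n - 1) x ^ 2| + |Λ⁻¹ * V n x * V (n + 1) x| := abs_sub _ _
      _ ≤ (|-(V n x)| + |Λ * V (n - 1) x ^ 2|) + |Λ⁻¹ * V n x * V (n + 1) x| :=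
          add_le_add (abs_add_le _ _) le_rfl
      _ ≤ (B + Λ * B ^ 2) + Λ⁻¹ * B ^ 2 := by rw [abs_neg]; exact add_le_add (add_le_add h1 e1) e2
      _ = B + (Λ + Λ⁻¹) * B ^ 2 := by ring
  have h := (convex_uIcc v u).norm_image_sub_le_of_norm_hasDerivWithin_le hder hbd
    left_mem_uIcc right_mem_uIcc
  rwa [Real.norm_eq_abs, Real.norm_eq_abs] at h

/-! ## The lattice law passes to continuous limits -/

/-- **CONTINUOUS LIMITS OF BOUNDED FRAMES SOLVE THE LATTICE.**  Let `V_j : ℤ → ℝ → ℝ` solve the renormalised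
dyadic lattice (`Λ > 0`) on `σ > A_j` with `A_j → −∞` and `|V_j n σ| ≤ B` there, and let `V_j → W`
continuously (`u_j → σ ⇒ V_j n u_j → W n σ`, every shell, every `σ`).  Then `W` solves the lattice at every
shell and every log-time, and every `W n` is continuous.
[cite: Tao2016AveragedNS, §1.2, §4 Lemma 4.1 (4.8), §6.4; elementary (integral form + dominated convergence + fundamental theorem of calculus)] -/
theorem lattice_law_of_cc {Λ B : ℝ} (hΛ : 0 < Λ) {V : ℕ → ℤ → ℝ → ℝ} {W : ℤ → ℝ → ℝ} {A : ℕ → ℝ}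
    (hA : Tendsto A atTop atBot)
    (hlaw : ∀ (j : ℕ) (n : ℤ) (σ : ℝ), A j < σ → HasDerivAt (V j n)
      (-(V j n σ) + Λ * V j (n - 1) σ ^ 2 - Λ⁻¹ * V j n σ * V j (n + 1) σ) σ)
    (hB : ∀ (j : ℕ) (n : ℤ) (σ : ℝ), A j < σ → |V j n σ| ≤ B)
    (hcc : ∀ (n : ℤ) (u : ℕ → ℝ) (σ : ℝ), Tendsto u atTop (𝓝 σ) →
      Tendsto (fun j => V j n (u j)) atTop (𝓝 (W n σ))) :
    (∀ n : ℤ, Continuous (W n)) ∧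
    ∀ (n : ℤ) (σ : ℝ), HasDerivAt (W n)
      (-(W n σ) + Λ * W (n - 1) σ ^ 2 - Λ⁻¹ * W n σ * W (n + 1) σ) σ := by
  set K : ℝ := B + (Λ + Λ⁻¹) * B ^ 2 with hK
  have hB0 : 0 ≤ B := (abs_nonneg _).trans (hB 0 0 (A 0 + 1) (by linarith))
  have hK0 : 0 ≤ K := add_nonneg hB0 (mul_nonneg (by positivity) (sq_nonneg B))
  have hpt : ∀ (n : ℤ) (σ : ℝ), Tendsto (fun j => V j n σ) atTop (𝓝 (W n σ)) :=
    fun n σ => hcc n _ σ tendsto_const_nhds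
  -- eventually every fixed log-time is inside the half-lines
  have hev : ∀ a : ℝ, ∀ᶠ j in atTop, A j < a := fun a => hA.eventually (eventually_lt_atBot a)
  -- the limit is `K`-Lipschitz, hence continuous
  have hWlip : ∀ (n : ℤ) (u v : ℝ), |W n u - W n v| ≤ K * |u - v| := by
    intro n u v
    have h1 : Tendsto (fun j => |V j n u - V j n v|) atTop (𝓝 |W n u - W n v|) :=
      (continuous_abs.tendsto _).comp ((hpt n u).sub (hpt n v))
    refine le_of_tendsto h1 ?_
    filter_upwards [hev u, hev v] with j hju hjv
    exact frame_lipschitz hΛ (hlaw j) (hB j) n hju hjv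
  have hWcont : ∀ n : ℤ, Continuous (W n) := fun n =>
    (LipschitzWith.of_dist_le_mul fun u v => by
      rw [Real.dist_eq, Real.dist_eq, Real.coe_toNNReal _ hK0]
      exact hWlip n u v : LipschitzWith (Real.toNNReal K) (W n)).continuous
  refine ⟨hWcont, fun n σ => ?_⟩
  -- right-hand sides
  set G : ℕ → ℝ → ℝ := fun j u =>
    -(V j n u) + Λ * V j (n - 1) u ^ 2 - Λ⁻¹ * V j n u * V j (n + 1) u with hG
  set Glim : ℝ → ℝ := fun u => -(W n u) + Λ * W (n - 1) u ^ 2 - Λ⁻¹ * W n u * W (n + 1) u with hGlim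
  have hGlimcont : Continuous Glim :=
    ((hWcont n).neg.add (continuous_const.mul ((hWcont (n - 1)).pow 2))).sub
      ((continuous_const.mul (hWcont n)).mul (hWcont (n + 1)))
  have hGpt : ∀ u : ℝ, Tendsto (fun j => G j u) atTop (𝓝 (Glim u)) := fun u =>
    ((hpt n u).neg.add (tendsto_const_nhds.mul ((hpt (n - 1) u).pow 2))).sub
      ((tendsto_const_nhds.mul (hpt n u)).mul (hpt (n + 1) u))
  -- frames are continuous on their half-lines
  have hVcont : ∀ (j : ℕ) (m : ℤ), ContinuousOn (V j m) (Ioi (A j)) := fun j m u hu =>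
    (hlaw j m u hu).continuousAt.continuousWithinAt
  have hGcont : ∀ j, ContinuousOn (G j) (Ioi (A j)) := fun j =>
    (((hVcont j n).neg).add (continuousOn_const.mul ((hVcont j (n - 1)).pow 2))).sub
      ((continuousOn_const.mul (hVcont j n)).mul (hVcont j (n + 1)))
  have hGbd : ∀ j, ∀ u, A j < u → |G j u| ≤ K := by
    intro j u hu
    have hΛi : 0 < Λ⁻¹ := inv_pos.2 hΛ
    have h1 := hB j n u hu; have h2 := hB j (n - 1) u hu; have h3 := hB j (n + 1) u hu
    have hB0 : 0 ≤ B := (abs_nonneg _).trans h1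
    have e1 : |Λ * V j (n - 1) u ^ 2| ≤ Λ * B ^ 2 := by
      rw [abs_mul, abs_of_pos hΛ, abs_pow]
      exact mul_le_mul_of_nonneg_left (pow_le_pow_left₀ (abs_nonneg _) h2 2) hΛ.le
    have e2 : |Λ⁻¹ * V j n u * V j (n + 1) u| ≤ Λ⁻¹ * B ^ 2 := by
      rw [abs_mul, abs_mul, abs_of_pos hΛi, mul_assoc, sq]
      exact mul_le_mul_of_nonneg_left (mul_le_mul h1 h3 (abs_nonneg _) hB0) hΛi.le
    calc |G j u| ≤ |-(V j n u) + Λ * V j (n - 1) u ^ 2| + |Λ⁻¹ * V j n u * V j (n + 1) u| :=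
          abs_sub _ _
      _ ≤ (|-(V j n u)| + |Λ * V j (n - 1) u ^ 2|) + |Λ⁻¹ * V j n u * V j (n + 1) u| :=
          add_le_add (abs_add_le _ _) le_rfl
      _ ≤ (B + Λ * B ^ 2) + Λ⁻¹ * B ^ 2 := by rw [abs_neg]; exact add_le_add (add_le_add h1 e1) e2
      _ = K := by rw [hK]; ring
  -- the integral form passes to the limit on `(σ - 1, σ + 1)`
  have hint : ∀ τ ∈ Ioo (σ - 1) (σ + 1), W n τ - W n σ = ∫ u in σ..τ, Glim u := by
    intro τ hτ
    have hseg : uIcc σ τ ⊆ Ioo (σ - 1) (σ + 1) := by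
      rcases le_total σ τ with h | h
      · rw [uIcc_of_le h]; exact fun u hu => ⟨by linarith [hu.1], lt_of_le_of_lt hu.2 hτ.2⟩
      · rw [uIcc_of_ge h]; exact fun u hu => ⟨lt_of_lt_of_le hτ.1 hu.1, by linarith [hu.2]⟩
    have hFTC : ∀ᶠ j in atTop, ∫ u in σ..τ, G j u = V j n τ - V j n σ := by
      filter_upwards [hev (σ - 1)] with j hj
      have hsub : uIcc σ τ ⊆ Ioi (A j) := fun u hu => lt_trans hj (hseg hu).1
      exact integral_eq_sub_of_hasDerivAt (fun u hu => hlaw j n u (hsub hu))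
        ((hGcont j).mono hsub).intervalIntegrable
    have hDCT : Tendsto (fun j => ∫ u in σ..τ, G j u) atTop (𝓝 (∫ u in σ..τ, Glim u)) := by
      refine tendsto_integral_filter_of_dominated_convergence (fun _ => K) ?_ ?_ ?_ ?_
      · filter_upwards [hev (σ - 1)] with j hj
        have hsub : uIoc σ τ ⊆ Ioi (A j) := fun u hu => lt_trans hj (hseg (uIoc_subset_uIcc hu)).1
        exact ((hGcont j).mono hsub).aestronglyMeasurable measurableSet_uIoc
      · filter_upwards [hev (σ - 1)] with j hj
        exact Eventually.of_forall fun u hu => by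
          rw [Real.norm_eq_abs]; exact hGbd j u (lt_trans hj (hseg (uIoc_subset_uIcc hu)).1)
      · exact intervalIntegrable_const
      · exact Eventually.of_forall fun u _ => hGpt u
    have hlim2 : Tendsto (fun j => V j n τ - V j n σ) atTop (𝓝 (W n τ - W n σ)) :=
      (hpt n τ).sub (hpt n σ)
    exact tendsto_nhds_unique hlim2 (hDCT.congr' (hFTC.mono fun j hj => hj))
  have hFTC2 : HasDerivAt (fun τ => ∫ u in σ..τ, Glim u) (Glim σ) σ :=
    integral_hasDerivAt_right IntervalIntegrable.refl
      (hGlimcont.stronglyMeasurableAtFilter _ _) hGlimcont.continuousAt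
  have hevW : W n =ᶠ[𝓝 σ] fun τ => W n σ + ∫ u in σ..τ, Glim u := by
    filter_upwards [Ioo_mem_nhds (show σ - 1 < σ by linarith) (show σ < σ + 1 by linarith)] with τ hτ
    rw [← hint τ hτ]; ring
  have h := (hFTC2.const_add (W n σ)).congr_of_eventuallyEq hevW
  simpa only [hGlim] using h

/-! ## The window-mass bound passes to the limit and gives the action clause -/

/-- **Uniform window mass passes to pointwise limits.** [folklore] -/
theorem windowMass_of_cc {B M : ℝ} {V : ℕ → ℤ → ℝ → ℝ} {W : ℤ → ℝ → ℝ} {A : ℕ → ℝ}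
    (hA : Tendsto A atTop atBot)
    (hcont : ∀ (j : ℕ) (n : ℤ), ContinuousOn (V j n) (Ioi (A j)))
    (hB : ∀ (j : ℕ) (n : ℤ) (σ : ℝ), A j < σ → |V j n σ| ≤ B)
    (hmass : ∀ (j : ℕ) (n : ℤ) (a b : ℝ), A j < a → a ≤ b → ∫ u in a..b, |V j n u| ≤ M)
    (hpt : ∀ (n : ℤ) (σ : ℝ), Tendsto (fun j => V j n σ) atTop (𝓝 (W n σ)))
    (n : ℤ) {a b : ℝ} (hab : a ≤ b) : ∫ u in a..b, |W n u| ≤ M := by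
  have hev : ∀ᶠ j in atTop, A j < a := hA.eventually (eventually_lt_atBot a)
  have hseg : uIcc a b = Icc a b := uIcc_of_le hab
  have hDCT : Tendsto (fun j => ∫ u in a..b, |V j n u|) atTop (𝓝 (∫ u in a..b, |W n u|)) := by
    refine tendsto_integral_filter_of_dominated_convergence (fun _ => B) ?_ ?_ ?_ ?_
    · filter_upwards [hev] with j hj
      have hsub : uIoc a b ⊆ Ioi (A j) := fun u hu => by
        have := uIoc_subset_uIcc hu; rw [hseg] at this; exact lt_of_lt_of_le hj this.1
      exact (continuous_abs.comp_continuousOn ((hcont j n).mono hsub)).aestronglyMeasurable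
        measurableSet_uIoc
    · filter_upwards [hev] with j hj
      exact Eventually.of_forall fun u hu => by
        have := uIoc_subset_uIcc hu; rw [hseg] at this
        rw [Real.norm_eq_abs, abs_abs]; exact hB j n u (lt_of_lt_of_le hj this.1)
    · exact intervalIntegrable_const
    · exact Eventually.of_forall fun u _ => (continuous_abs.tendsto _).comp (hpt n u)
  refine le_of_tendsto hDCT ?_
  filter_upwards [hev] with j hj
  exact hmass j n a b hj hab

/-- **Window mass ⇒ integrable with the same bound.**  A continuous `f : ℝ → ℝ` with `∫_a^b |f| ≤ M` for
all `a ≤ b` is integrable on `ℝ` with `∫ |f| ≤ M`. [folklore] -/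
theorem integrable_of_windowMass {f : ℝ → ℝ} {M : ℝ} (hf : Continuous f)
    (hmass : ∀ a b : ℝ, a ≤ b → ∫ u in a..b, |f u| ≤ M) :
    Integrable (fun u => |f u|) ∧ ∫ u, |f u| ≤ M := by
  have hnorm : ∀ a b : ℝ, a ≤ b → ∫ u in a..b, ‖f u‖ ≤ M := fun a b hab => by
    simpa only [Real.norm_eq_abs] using hmass a b hab
  have hloc : ∀ a b : ℝ, IntegrableOn f (Ioc a b) := fun a b =>
    (hf.continuousOn.integrableOn_Icc (a := a) (b := b)).mono_set Ioc_subset_Icc_self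
  have h1 : IntegrableOn f (Iic 0) :=
    integrableOn_Iic_of_intervalIntegral_norm_bounded M 0 (l := atBot) (a := id)
      (fun i => hloc i 0) tendsto_id (by
        filter_upwards [eventually_le_atBot (0 : ℝ)] with i hi using hnorm i 0 hi)
  have h2 : IntegrableOn f (Ioi 0) :=
    integrableOn_Ioi_of_intervalIntegral_norm_bounded M 0 (l := atTop) (b := id)
      (fun i => hloc 0 i) tendsto_id (by
        filter_upwards [eventually_ge_atTop (0 : ℝ)] with i hi using hnorm 0 i hi)
  have hint : Integrable f := by
    have := h1.union h2
    rw [Iic_union_Ioi, integrableOn_univ] at this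
    exact this
  refine ⟨hint.abs, ?_⟩
  have hlim : Tendsto (fun i : ℕ => ∫ u in (-(i : ℝ))..(i : ℝ), |f u|) atTop (𝓝 (∫ u, |f u|)) :=
    intervalIntegral_tendsto_integral hint.abs
      (tendsto_neg_atTop_atBot.comp tendsto_natCast_atTop_atTop) tendsto_natCast_atTop_atTop
  exact le_of_tendsto' hlim fun i => hmass _ _ (by
    have : (0 : ℝ) ≤ i := Nat.cast_nonneg i; linarith)

/-! ## The kill criteria: frames with a continuous limit, and bare bounded frames -/

/-- **KILL CRITERION, FRAME-LIMIT FORM (scalar).**  Suppose that at arbitrarily small `ε₀` there are scalar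
frames `V_j : ℤ → ℝ → ℝ` solving the renormalised dyadic lattice (`Λ = bigLam ε₀`) on half-lines `σ > A_j`,
`A_j → −∞`, with: a uniform bound `|V_j n σ| ≤ B`; a uniform WINDOW-MASS bound `∫_a^b |V_j n| ≤ M`
(`A_j < a ≤ b`); a per-shell FORWARD ENERGY bound `e^{2σ} V_j n(σ)² ≤ P_n` for `σ ≥ σ₁(n)` (uniform in
`j`); PERSISTENT FIRING at fixed recentred log-times (`c ≤ |V_j (n₀+k) (τ_k)|` for all large `j`, some
`τ_k ≥ σ₀`, every `k`); and a continuous limit `W` (`u_j → σ ⇒ V_j n u_j → W n σ`).  Then `TailRatchet` fails.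
[cite: Tao2016AveragedNS, §1.2, §4 Lemma 4.1 (4.8), §6.4; cell vocabulary] -/
theorem tailRatchet_false_of_scalarFrameLimit
    (hF : ∀ ε : ℝ, 0 < ε → ∃ ε₀ : ℝ, 0 < ε₀ ∧ ε₀ ≤ ε ∧
      ∃ (V : ℕ → ℤ → ℝ → ℝ) (W : ℤ → ℝ → ℝ) (A : ℕ → ℝ) (B M : ℝ),
        Tendsto A atTop atBot ∧
        (∀ (j : ℕ) (n : ℤ) (σ : ℝ), A j < σ → HasDerivAt (V j n)
          (-(V j n σ) + bigLam ε₀ * V j (n - 1) σ ^ 2 - (bigLam ε₀)⁻¹ * V j n σ * V j (n + 1) σ) σ) ∧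
        (∀ (j : ℕ) (n : ℤ) (σ : ℝ), A j < σ → |V j n σ| ≤ B) ∧
        (∀ (j : ℕ) (n : ℤ) (a b : ℝ), A j < a → a ≤ b → ∫ u in a..b, |V j n u| ≤ M) ∧
        (∀ n : ℤ, ∃ σ₁ P : ℝ, ∀ (j : ℕ) (σ : ℝ), σ₁ ≤ σ → A j < σ →
          Real.exp (2 * σ) * V j n σ ^ 2 ≤ P) ∧
        (∃ c : ℝ, 0 < c ∧ ∃ (n₀ : ℤ) (σ₀ : ℝ), ∀ k : ℕ, ∃ τ : ℝ, σ₀ ≤ τ ∧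
          ∀ᶠ j in atTop, c ≤ |V j (n₀ + k) τ|) ∧
        (∀ (n : ℤ) (u : ℕ → ℝ) (σ : ℝ), Tendsto u atTop (𝓝 σ) →
          Tendsto (fun j => V j n (u j)) atTop (𝓝 (W n σ)))) :
    ¬ TailRatchet := by
  refine tailRatchet_false_of_scalarPersistentFiring fun ε hε => ?_
  obtain ⟨ε₀, hε₀, hle, V, W, A, B, M, hA, hlaw, hB, hmass, hfwd, ⟨c, hc, n₀, σ₀, hfire⟩, hcc⟩ := hF ε hε
  have hΛ : 0 < bigLam ε₀ := bigLam_pos (by linarith)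
  have hpt : ∀ (n : ℤ) (σ : ℝ), Tendsto (fun j => V j n σ) atTop (𝓝 (W n σ)) :=
    fun n σ => hcc n _ σ tendsto_const_nhds
  have hev : ∀ a : ℝ, ∀ᶠ j in atTop, A j < a := fun a => hA.eventually (eventually_lt_atBot a)
  obtain ⟨hWcont, hWlaw⟩ := lattice_law_of_cc hΛ hA hlaw hB hcc
  have hVcont : ∀ (j : ℕ) (n : ℤ), ContinuousOn (V j n) (Ioi (A j)) := fun j n u hu =>
    (hlaw j n u hu).continuousAt.continuousWithinAt
  refine ⟨ε₀, hε₀, hle, W, hWlaw, ?_, ?_, ?_, c, hc, n₀, σ₀, fun K => ?_⟩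
  · -- the action clause from the window-mass bound
    refine ⟨M, fun n => ?_⟩
    exact integrable_of_windowMass (hWcont n) fun a b hab =>
      windowMass_of_cc hA hVcont hB hmass hpt n hab
  · -- forward energy bound
    intro n
    obtain ⟨σ₁, P, hP⟩ := hfwd n
    refine ⟨σ₁, P, fun σ hσ => ?_⟩
    have h1 : Tendsto (fun j => Real.exp (2 * σ) * V j n σ ^ 2) atTop
        (𝓝 (Real.exp (2 * σ) * W n σ ^ 2)) := tendsto_const_nhds.mul ((hpt n σ).pow 2)
    refine le_of_tendsto h1 ?_
    filter_upwards [hev σ] with j hj using hP j σ hσ hj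
  · -- uniform bound
    refine ⟨B, fun n σ => ?_⟩
    refine le_of_tendsto ((continuous_abs.tendsto _).comp (hpt n σ)) ?_
    filter_upwards [hev σ] with j hj using hB j n σ hj
  · -- persistent firing
    obtain ⟨τ, hτ, hfireK⟩ := hfire K
    refine ⟨K, le_rfl, τ, hτ, ?_⟩
    exact ge_of_tendsto ((continuous_abs.tendsto _).comp (hpt (n₀ + K) τ)) hfireK

/-- **KILL CRITERION, BARE-FRAME FORM (scalar; the extraction included).**  As
`tailRatchet_false_of_scalarFrameLimit` but WITHOUT a limit in the hypotheses: bounded scalar frames of the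
renormalised dyadic lattice on growing half-lines, with a uniform window-mass bound, per-shell forward energy
bounds and persistent firing at fixed recentred log-times, at arbitrarily small `ε₀`, refute `TailRatchet`
(equicontinuity from the equation, Arzelà–Ascoli along a subsequence, then the frame-limit form).
[cite: Tao2016AveragedNS, §1.2, §4 Lemma 4.1 (4.8), §6.4; cell vocabulary] -/
theorem tailRatchet_false_of_scalarFrames
    (hF : ∀ ε : ℝ, 0 < ε → ∃ ε₀ : ℝ, 0 < ε₀ ∧ ε₀ ≤ ε ∧
      ∃ (V : ℕ → ℤ → ℝ → ℝ) (A : ℕ → ℝ) (B M : ℝ),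
        Tendsto A atTop atBot ∧
        (∀ (j : ℕ) (n : ℤ) (σ : ℝ), A j < σ → HasDerivAt (V j n)
          (-(V j n σ) + bigLam ε₀ * V j (n - 1) σ ^ 2 - (bigLam ε₀)⁻¹ * V j n σ * V j (n + 1) σ) σ) ∧
        (∀ (j : ℕ) (n : ℤ) (σ : ℝ), A j < σ → |V j n σ| ≤ B) ∧
        (∀ (j : ℕ) (n : ℤ) (a b : ℝ), A j < a → a ≤ b → ∫ u in a..b, |V j n u| ≤ M) ∧
        (∀ n : ℤ, ∃ σ₁ P : ℝ, ∀ (j : ℕ) (σ : ℝ), σ₁ ≤ σ → A j < σ →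
          Real.exp (2 * σ) * V j n σ ^ 2 ≤ P) ∧
        (∃ c : ℝ, 0 < c ∧ ∃ (n₀ : ℤ) (σ₀ : ℝ), ∀ k : ℕ, ∃ τ : ℝ, σ₀ ≤ τ ∧
          ∀ᶠ j in atTop, c ≤ |V j (n₀ + k) τ|)) :
    ¬ TailRatchet := by
  refine tailRatchet_false_of_scalarFrameLimit fun ε hε => ?_
  obtain ⟨ε₀, hε₀, hle, V, A, B, M, hA, hlaw, hB, hmass, hfwd, ⟨c, hc, n₀, σ₀, hfire⟩⟩ := hF ε hε
  have hΛ : 0 < bigLam ε₀ := bigLam_pos (by linarith)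
  have hev : ∀ a : ℝ, ∀ᶠ j in atTop, A j < a := fun a => hA.eventually (eventually_lt_atBot a)
  -- Arzelà–Ascoli on the frames (shell-indexed real paths)
  have hBB : ∀ (n : ℤ) (a : ℝ), ∃ C : ℝ, ∃ J : ℕ, ∀ j, J ≤ j → ∀ u : ℝ, a ≤ u → ‖V j n u‖ ≤ C := by
    intro n a
    obtain ⟨J, hJ⟩ := eventually_atTop.1 (hev a)
    exact ⟨B, J, fun j hj u hu => by
      rw [Real.norm_eq_abs]; exact hB j n u (lt_of_lt_of_le (hJ j hj) hu)⟩
  have hLL : ∀ (n : ℤ) (a : ℝ), ∃ K : ℝ, ∃ J : ℕ, ∀ j, J ≤ j → ∀ u v : ℝ, a ≤ u → a ≤ v →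
      ‖V j n u - V j n v‖ ≤ K * |u - v| := by
    intro n a
    obtain ⟨J, hJ⟩ := eventually_atTop.1 (hev a)
    exact ⟨B + (bigLam ε₀ + (bigLam ε₀)⁻¹) * B ^ 2, J, fun j hj u v hu hv => by
      rw [Real.norm_eq_abs]
      exact frame_lipschitz hΛ (hlaw j) (hB j) n (lt_of_lt_of_le (hJ j hj) hu)
        (lt_of_lt_of_le (hJ j hj) hv)⟩
  obtain ⟨φ, hφ, W, hW⟩ :=
    Summit.NavierStokesRegularity.NavierStokesRegularity.Cruxes.MinimalBlowupExtraction.Extraction.exists_subseq_continuousLimit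
      V hBB hLL
  have hφt : Tendsto φ atTop atTop := hφ.tendsto_atTop
  refine ⟨ε₀, hε₀, hle, fun j => V (φ j), W, fun j => A (φ j), B, M, hA.comp hφt,
    fun j => hlaw (φ j), fun j => hB (φ j), fun j => hmass (φ j), fun n => ?_,
    ⟨c, hc, n₀, σ₀, fun k => ?_⟩, hW⟩
  · obtain ⟨σ₁, P, hP⟩ := hfwd n
    exact ⟨σ₁, P, fun j σ hσ hj => hP (φ j) σ hσ hj⟩
  · obtain ⟨τ, hτ, hfireK⟩ := hfire k
    exact ⟨τ, hτ, hφt.eventually hfireK⟩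

end WakeRatchetDyadicScalarEternal

end Summit.NavierStokesRegularity.NavierStokesRegularity.Theorems

end
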